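import Summits.HubbardSuperconductivity.HubbardSuperconductivity.Theorems.AnisotropyChordTransferCompressibility

/-!
# PartN26 — CONJECTURE MON-n (sector gap monotone in the particle number towards half filling), typed in tree vocabulary

Theory seat `hubbard-h0-rotor-theory-1`, cycle 20 (memo ROTOR-THEORY-20 §264, register R20).  For the spin-½ XXZ / hard-core-boson
Hamiltonian `H(Δ)` on the `L × L` torus (`V = L²` sites), write `γ(M)` for the full spectral gap of `H(Δ)` restricted to the sector
`Sᶻ_tot = M` above its sector ground energy `E(M)`; `M = n − V/2` for `n` particles.  The conjecture, extracted from the exact-diagonalisation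
tables of cycles 15–17 (tori 4×4 (n ≤ 8), 5×5 (n ≤ 6), 6×4 (n ≤ 8), 6×6 (n ≤ 4), 8×4 (n ≤ 5), 8×8 (n ≤ 4), rings C₈, C₁₂, C₁₆; zero violations for
Δ ∈ [−0.3, 1]; violations only for Δ ≤ −0.4 at the last step to half filling; in 1D XX it is the closed form `γ_n = ε₁ sin(nπ/V)/sin(π/V)`):

  MON-n(Δ):  `γ(M) ≤ γ(M+1)` whenever `1 − V/2 ≤ M` and `M + 1 ≤ 0` (i.e. `1 ≤ n < n+1 ≤ V/2`).

In the tree's Temple-form vocabulary (`SectorGapAtLeast L Δ M g` = «gap of sector `M` is `≥ g`», file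
`AnisotropyChordTransferCompressibility`), monotonicity of the gap is the transfer of every certified lower bound `g` from `M` to `M+1`.
Together with `γ(1 − V/2) = ε₁` (one-magnon sector, exact) and particle–hole symmetry `M ↔ −M` it gives END_n (`γ(M) ≥ ε₁`) in every sector,
hence — via the cycle-12…19 transfer chain — the H0 · PC rotor rung (`FerroSideChord`).  The step `n = 1 → 2` is GM₂ (proved, memo 16);
`n = 2 → 3` is stronger than END₃.  Statement only (a conjecture is never a Literature fact); the consumer lemma below is proved.
-/

-- Port of theory seat `hubbard-h0-rotor-theory-1` cycle20/lean/PartN26.lean (sha16 dba9c0bc030c5762) verbatim modulo this header,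
-- `set_option linter.dupNamespace false` and lint fixes; prover seat `hubbard-h0-rotor-p1` g21, `--supports stmt-HubbardSuperconductivity-19089`.

set_option linter.dupNamespace false

open Literature.MathematicalPhysics.QuantumLattice Literature.Probability.LatticeModels

namespace Summit.HubbardSuperconductivity.HubbardSuperconductivity.Theorems.AnisotropyChord.Transfer

/-- **CONJECTURE MON-n** (sector gap monotone in `n` up to half filling), Temple form: every certified gap lower bound transfers from the
sector `M` to the sector `M + 1` as long as `1 − V/2 ≤ M` and `M + 1 ≤ 0`.
[conjecture: theory seat hubbard-h0-rotor-theory-1, cycle 20, memo ROTOR-THEORY-20 §264; ED evidence cycles 15–17] -/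
def SectorGapMonotoneInN (Δ : ℝ) : Prop :=
  ∀ (L : ℕ) [NeZero L], 2 ≤ L → ∀ M g : ℝ,
    1 - (Fintype.card (TorusSite 2 L) : ℝ) / 2 ≤ M → M + 1 ≤ 0 →
      SectorGapAtLeast L Δ M g → SectorGapAtLeast L Δ (M + 1) g

/-- Consumer: under MON-n a gap bound in the one-magnon sector `M₁ = 1 − V/2` propagates to every sector `M₁ + k ≤ 0`
(induction on `k`). [this file] -/
theorem sectorGapAtLeast_of_monotone {Δ : ℝ} (hmon : SectorGapMonotoneInN Δ) (L : ℕ) [NeZero L] (hL : 2 ≤ L) (g : ℝ)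
    (h₁ : SectorGapAtLeast L Δ (1 - (Fintype.card (TorusSite 2 L) : ℝ) / 2) g) :
    ∀ k : ℕ, 1 - (Fintype.card (TorusSite 2 L) : ℝ) / 2 + k ≤ 0 →
      SectorGapAtLeast L Δ (1 - (Fintype.card (TorusSite 2 L) : ℝ) / 2 + k) g := by
  intro k
  induction k with
  | zero => intro _; simpa using h₁
  | succ k ih =>
      intro hk
      have hk' : 1 - (Fintype.card (TorusSite 2 L) : ℝ) / 2 + k ≤ 0 := by
        have : ((k + 1 : ℕ) : ℝ) = (k : ℝ) + 1 := by push_cast; ring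
        rw [this] at hk; linarith
      have step := hmon L hL (1 - (Fintype.card (TorusSite 2 L) : ℝ) / 2 + k) g (by
        have : (0:ℝ) ≤ k := Nat.cast_nonneg k
        linarith) (by
        have : ((k + 1 : ℕ) : ℝ) = (k : ℝ) + 1 := by push_cast; ring
        rw [this] at hk; linarith) (ih hk')
      have : (1 - (Fintype.card (TorusSite 2 L) : ℝ) / 2 + ((k + 1 : ℕ) : ℝ))
          = (1 - (Fintype.card (TorusSite 2 L) : ℝ) / 2 + k) + 1 := by push_cast; ring
      rw [this]; exact step

end Summit.HubbardSuperconductivity.HubbardSuperconductivity.Theorems.AnisotropyChord.Transfer
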